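import Mathlib
import HarnessLib

/-!
# `FemtoCurvatureSkewness` — the periodised lazy-walk kernel (stub `TreeRatioFloor`, crux stmt-QuantumFields-9365)

For the discrete circle `ZMod L` we introduce the lazy symbol `q(a) = (1 + cos θ_a)/2 = cos²(θ_a/2)`,
`θ_a = 2π a/L`, and the periodised lazy-walk kernel
`λ_i(y) = 4^{-i} Σ_{0 ≤ s ≤ 2i, L ∣ s-i-y} C(2i, s)` (the law at time `i` of the walk on `ℤ/L` with steps
`+1, -1` w.p. `1/4` and `0` w.p. `1/2`, i.e. half of a simple `±1` walk of `2i` steps, started at `0`).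
Main facts: the character sum `Σ_a exp(i z θ_a) = L·[L ∣ z]` (`charSum`) and the Fourier representation
`Σ_a q(a)^i exp(-i y θ_a) = L λ_i(y)` (`fourier_lam`), whence `Σ_a q(a)^i cos(y θ_a) = L λ_i(y)` and the evenness
of `λ_i`; elementary bounds `0 ≤ λ_i ≤ 1`, `λ_i(y) = 0` for `i < y < L - i`, `λ_i(v) ≥ C(2i,i+v)/4^i`.
Mathlib only.
-/

noncomputable section

namespace Summit.QuantumFields.YangMills.Theorems.FemtoCurvatureSkewness

open Finset
open scoped BigOperators

namespace TreeRatio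

variable (L : ℕ)

/-- The lazy symbol `q(a) = (1 + cos(2πa/L))/2 ∈ [0, 1]` of the circle `ZMod L`. -/
def lazyQ (a : ZMod L) : ℝ := (1 + Real.cos (2 * Real.pi * (a.val : ℝ) / L)) / 2

/-- The index set of the periodised lazy kernel: `{s ≤ 2i : L ∣ s - i - y}`. -/
def lamSet (i : ℕ) (y : ℤ) : Finset ℕ := (range (2 * i + 1)).filter (fun s => (L : ℤ) ∣ ((s : ℤ) - i - y))

/-- The periodised lazy-walk kernel `λ_i(y) = 4^{-i} Σ_{s ≤ 2i, L ∣ s-i-y} C(2i, s)` on `ℤ` (it is `L`-periodic). -/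
def lam (i : ℕ) (y : ℤ) : ℝ := (∑ s ∈ lamSet L i y, ((2 * i).choose s : ℝ)) / 4 ^ i

/-! ## Elementary properties -/

/-- `0 ≤ q(a)`. -/
theorem lazyQ_nonneg (a : ZMod L) : 0 ≤ lazyQ L a := by
  unfold lazyQ
  have := Real.neg_one_le_cos (2 * Real.pi * (a.val : ℝ) / L)
  linarith

/-- `q(a) ≤ 1`. -/
theorem lazyQ_le_one (a : ZMod L) : lazyQ L a ≤ 1 := by
  unfold lazyQ
  have := Real.cos_le_one (2 * Real.pi * (a.val : ℝ) / L)
  linarith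

/-- `4 q(a) = 2 + 2cos θ_a = 4 - k̂²(a)`. -/
theorem four_mul_lazyQ (a : ZMod L) : 4 * lazyQ L a = 4 - (2 - 2 * Real.cos (2 * Real.pi * (a.val : ℝ) / L)) := by
  unfold lazyQ; ring

/-- `λ_i(y) ≥ 0`. -/
theorem lam_nonneg (i : ℕ) (y : ℤ) : 0 ≤ lam L i y := by
  unfold lam
  positivity

/-- `λ_i(y) ≤ 1` (the whole row sums to `4^i`). -/
theorem lam_le_one (i : ℕ) (y : ℤ) : lam L i y ≤ 1 := by
  unfold lam
  rw [div_le_one (by positivity)]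
  calc ∑ s ∈ lamSet L i y, ((2 * i).choose s : ℝ) ≤ ∑ s ∈ range (2 * i + 1), ((2 * i).choose s : ℝ) :=
        sum_le_sum_of_subset_of_nonneg (filter_subset _ _) (fun _ _ _ => by positivity)
    _ = (4 : ℝ) ^ i := by
        have h := Nat.sum_range_choose (2 * i)
        rw [pow_mul, show (2 : ℕ) ^ 2 = 4 by norm_num] at h
        exact_mod_cast h

/-- The kernel vanishes before the walk can reach `y`: `λ_i(y) = 0` if `i < y` and `i + y < L`. -/
theorem lam_eq_zero_of_lt {i : ℕ} {y : ℤ} (hiy : (i : ℤ) < y) (hL : (i : ℤ) + y < L) : lam L i y = 0 := by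
  unfold lam
  have hempty : lamSet L i y = ∅ := by
    refine filter_eq_empty_iff.mpr fun s hs hdvd => ?_
    have hs' : s < 2 * i + 1 := mem_range.mp hs
    have hne : (s : ℤ) - i - y ≠ 0 := by omega
    have habs := Int.le_of_dvd (abs_pos.mpr hne) ((dvd_abs _ _).mpr hdvd)
    rw [abs_of_neg (by omega)] at habs
    omega
  rw [hempty, sum_empty, zero_div]

/-- The unwrapped term: `λ_i(v) ≥ C(2i, i+v)/4^i` for `0 ≤ v ≤ i`. -/
theorem choose_div_le_lam {i v : ℕ} (hv : v ≤ i) : ((2 * i).choose (i + v) : ℝ) / 4 ^ i ≤ lam L i v := by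
  unfold lam
  refine div_le_div_of_nonneg_right ?_ (by positivity)
  have hmem : i + v ∈ lamSet L i v := by
    refine mem_filter.mpr ⟨mem_range.mpr (by omega), ?_⟩
    have : ((i + v : ℕ) : ℤ) - i - (v : ℕ) = 0 := by push_cast; ring
    rw [this]
    exact dvd_zero _
  exact single_le_sum (f := fun s => ((2 * i).choose s : ℝ)) (fun _ _ => by positivity) hmem

/-! ## Character sums and the Fourier representation -/

/-- The lazy symbol through half-angle exponentials: `q(a) = ((e^{iθ/2} + e^{-iθ/2})/2)²`. -/
theorem lazyQ_eq_exp_sq (a : ZMod L) :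
    ((lazyQ L a : ℝ) : ℂ) =
      ((Complex.exp (((2 * Real.pi * (a.val : ℝ) / L / 2 : ℝ) : ℂ) * Complex.I) +
        Complex.exp (-(((2 * Real.pi * (a.val : ℝ) / L / 2 : ℝ) : ℂ)) * Complex.I)) / 2) ^ 2 := by
  have h1 : lazyQ L a = Real.cos (2 * Real.pi * (a.val : ℝ) / L / 2) ^ 2 := by
    rw [lazyQ, Real.cos_sq, mul_div_cancel₀ _ (two_ne_zero)]; ring
  rw [h1]
  push_cast
  rw [← Complex.two_cos]
  ring

/-- **Generating identity of the lazy walk**: `q(a)^i e^{i y θ_a} = 4^{-i} Σ_{s ≤ 2i} C(2i,s) e^{i (s-i+y) θ_a}`. -/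
theorem lazyQ_pow_mul_exp (a : ZMod L) (i : ℕ) (y : ℤ) :
    ((lazyQ L a : ℝ) : ℂ) ^ i * Complex.exp ((y : ℂ) * ((2 * Real.pi * (a.val : ℝ) / L : ℝ) : ℂ) * Complex.I) =
      ((4 : ℂ) ^ i)⁻¹ * ∑ s ∈ range (2 * i + 1), ((2 * i).choose s : ℂ) *
        Complex.exp ((((s : ℤ) - i + y : ℤ) : ℂ) * ((2 * Real.pi * (a.val : ℝ) / L : ℝ) : ℂ) * Complex.I) := by
  set θ : ℝ := 2 * Real.pi * (a.val : ℝ) / L with hθ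
  set ep : ℂ := Complex.exp (((θ / 2 : ℝ) : ℂ) * Complex.I) with hep
  set em : ℂ := Complex.exp (-((θ / 2 : ℝ) : ℂ) * Complex.I) with hem
  rw [lazyQ_eq_exp_sq, ← pow_mul, div_pow, add_pow, sum_div, sum_mul, mul_sum]
  refine sum_congr rfl fun s hs => ?_
  have hs' : s ≤ 2 * i := Nat.lt_succ_iff.mp (mem_range.mp hs)
  have h4 : (2 : ℂ) ^ (2 * i) = 4 ^ i := by rw [pow_mul]; norm_num
  rw [h4]
  have hexp : ep ^ s * em ^ (2 * i - s) * Complex.exp ((y : ℂ) * ((θ : ℝ) : ℂ) * Complex.I) =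
      Complex.exp ((((s : ℤ) - i + y : ℤ) : ℂ) * ((θ : ℝ) : ℂ) * Complex.I) := by
    rw [hep, hem, ← Complex.exp_nat_mul, ← Complex.exp_nat_mul, ← Complex.exp_add, ← Complex.exp_add]
    congr 1
    push_cast [Nat.cast_sub hs']
    ring
  rw [← hexp, div_eq_mul_inv]
  ring

variable [NeZero L]


/-- **Character orthogonality on `ZMod L`**: `Σ_a exp(i z θ_a) = L` if `L ∣ z` and `0` otherwise. -/
theorem charSum (z : ℤ) :
    ∑ a : ZMod L, Complex.exp ((z : ℂ) * ((2 * Real.pi * (a.val : ℝ) / L : ℝ) : ℂ) * Complex.I) =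
      if (L : ℤ) ∣ z then (L : ℂ) else 0 := by
  -- adapted from Summits/AnomalousDissipation/.../MomentParityQuarticGateFourierDictionaryPart3.lean
  -- (`sum_exp_two_pi_mul_div`)
  set ζ : ℂ := Complex.exp (2 * Real.pi * Complex.I * z / L) with hζ
  have hL0 : (L : ℂ) ≠ 0 := Nat.cast_ne_zero.2 (NeZero.ne L)
  have hterm : ∀ a : ZMod L,
      Complex.exp ((z : ℂ) * ((2 * Real.pi * (a.val : ℝ) / L : ℝ) : ℂ) * Complex.I) = ζ ^ a.val := by
    intro a
    rw [hζ, ← Complex.exp_nat_mul]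
    congr 1
    push_cast
    ring
  simp_rw [hterm]
  rw [show ∑ a : ZMod L, ζ ^ a.val = ∑ j ∈ Finset.range L, ζ ^ j from
    Finset.sum_nbij' (fun a => a.val) (fun j => (j : ZMod L)) (fun a _ => Finset.mem_range.mpr (ZMod.val_lt a))
      (fun j _ => Finset.mem_univ _) (fun a _ => ZMod.natCast_zmod_val a)
      (fun j hj => ZMod.val_natCast_of_lt (Finset.mem_range.mp hj)) (fun a _ => rfl)]
  have hζL : ζ ^ L = 1 := by
    rw [hζ, ← Complex.exp_nat_mul, show (L : ℂ) * (2 * Real.pi * Complex.I * z / L) =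
      z * (2 * Real.pi * Complex.I) by field_simp]
    exact Complex.exp_int_mul_two_pi_mul_I z
  split_ifs with hdvd
  · obtain ⟨q, hq⟩ := hdvd
    have hζ1 : ζ = 1 := by
      rw [hζ, hq, show (2 * Real.pi * Complex.I * (((L : ℤ) * q : ℤ) : ℂ) / L) = q * (2 * Real.pi * Complex.I) by
        push_cast; field_simp]
      exact Complex.exp_int_mul_two_pi_mul_I q
    simp [hζ1]
  · have hζ1 : ζ ≠ 1 := fun h1 => hdvd (by
      rw [hζ, Complex.exp_eq_one_iff] at h1
      obtain ⟨m, hm⟩ := h1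
      have h2pi : (2 * Real.pi * Complex.I : ℂ) ≠ 0 := by simp [Real.pi_ne_zero, Complex.I_ne_zero]
      have key : (z : ℂ) = ((L * m : ℤ) : ℂ) := by
        field_simp at hm
        push_cast
        linear_combination hm
      exact ⟨m, by exact_mod_cast key⟩)
    rw [geom_sum_eq hζ1, hζL, sub_self, zero_div]

/-- **Fourier representation of the periodised lazy kernel**: `Σ_a q(a)^i e^{i y θ_a} = L λ_i(-y)`. -/
theorem fourier_lam (i : ℕ) (y : ℤ) :
    ∑ a : ZMod L, ((lazyQ L a : ℝ) : ℂ) ^ i *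
        Complex.exp ((y : ℂ) * ((2 * Real.pi * (a.val : ℝ) / L : ℝ) : ℂ) * Complex.I) =
      (((L : ℝ) * lam L i (-y) : ℝ) : ℂ) := by
  simp_rw [lazyQ_pow_mul_exp]
  rw [← mul_sum, sum_comm]
  simp_rw [← mul_sum, charSum]
  -- match with the definition of `λ`
  rw [lam, lamSet]
  push_cast
  have hfilter : (range (2 * i + 1)).filter (fun s : ℕ => (L : ℤ) ∣ (s : ℤ) - i - -y) =
      (range (2 * i + 1)).filter (fun s : ℕ => (L : ℤ) ∣ (s : ℤ) - i + y) :=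
    filter_congr (fun s _ => by rw [sub_neg_eq_add])
  rw [hfilter]
  simp_rw [mul_ite, mul_zero]
  rw [← sum_filter, ← sum_mul, div_eq_mul_inv]
  ring

/-- Real form: `Σ_a q(a)^i cos(y θ_a) = L λ_i(-y)`. -/
theorem sum_lazyQ_pow_mul_cos (i : ℕ) (y : ℤ) :
    ∑ a : ZMod L, lazyQ L a ^ i * Real.cos ((y : ℝ) * (2 * Real.pi * (a.val : ℝ) / L)) = L * lam L i (-y) := by
  have h := congrArg Complex.re (fourier_lam L i y)
  rw [Complex.ofReal_re, Complex.re_sum] at h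
  rw [← h]
  refine sum_congr rfl fun a _ => ?_
  rw [← Complex.ofReal_pow, ← Complex.ofReal_intCast, ← Complex.ofReal_mul, Complex.re_ofReal_mul,
    Complex.exp_ofReal_mul_I_re]

/-- The periodised lazy kernel is even: `λ_i(-y) = λ_i(y)`. -/
theorem lam_neg (i : ℕ) (y : ℤ) : lam L i (-y) = lam L i y := by
  have h1 := sum_lazyQ_pow_mul_cos L i y
  have h2 := sum_lazyQ_pow_mul_cos L i (-y)
  rw [neg_neg] at h2
  have h3 : ∑ a : ZMod L, lazyQ L a ^ i * Real.cos (((-y : ℤ) : ℝ) * (2 * Real.pi * (a.val : ℝ) / L)) =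
      ∑ a : ZMod L, lazyQ L a ^ i * Real.cos ((y : ℝ) * (2 * Real.pi * (a.val : ℝ) / L)) := by
    refine sum_congr rfl fun a _ => ?_
    push_cast
    rw [neg_mul, Real.cos_neg]
  have hL : (L : ℝ) ≠ 0 := Nat.cast_ne_zero.mpr (NeZero.ne L)
  have : (L : ℝ) * lam L i (-y) = L * lam L i y := by rw [← h1, ← h2, h3]
  exact mul_left_cancel₀ hL this

/-- Real form with the natural sign: `Σ_a q(a)^i cos(y θ_a) = L λ_i(y)`. -/
theorem sum_lazyQ_pow_mul_cos' (i : ℕ) (y : ℤ) :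
    ∑ a : ZMod L, lazyQ L a ^ i * Real.cos ((y : ℝ) * (2 * Real.pi * (a.val : ℝ) / L)) = L * lam L i y := by
  rw [sum_lazyQ_pow_mul_cos, lam_neg]

end TreeRatio

/-- **Character orthogonality on `ZMod L`** (registered sub-goal `TreeRatioCharSum`). -/
theorem TreeRatioCharSum : ∀ (L : ℕ) [NeZero L] (z : ℤ), ∑ a : ZMod L, Complex.exp ((z : ℂ) * ((2 * Real.pi * (a.val : ℝ) / L : ℝ) : ℂ) * Complex.I) = if (L : ℤ) ∣ z then (L : ℂ) else 0 :=
  fun L _ z => TreeRatio.charSum L z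

end Summit.QuantumFields.YangMills.Theorems.FemtoCurvatureSkewness

end
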